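import Mathlib
import HarnessLib
import Literature.Analysis.FluidPDE.CurlIsometryCovariance
import Summits.NavierStokesRegularity.NavierStokesRegularity.Theses.AxisTwistDoor
import Summits.NavierStokesRegularity.NavierStokesRegularity.Theses.FilamentPinchDoor
import Summits.NavierStokesRegularity.NavierStokesRegularity.Theses.HalfSpaceWindowDoor
import Summits.NavierStokesRegularity.NavierStokesRegularity.Theorems.AxisTwistDoorTiltDominationLocDefs
import Summits.NavierStokesRegularity.NavierStokesRegularity.Theorems.AxisTwistDoorTiltDominationLocRigidity
import Summits.NavierStokesRegularity.NavierStokesRegularity.Theorems.AxisTwistDoorTiltDominationLocEnergyClass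
import Summits.NavierStokesRegularity.NavierStokesRegularity.Theorems.PoloidalWindowDoorPoloidalWindowRigidityRotate
import Summits.NavierStokesRegularity.NavierStokesRegularity.Theorems.PoloidalWindowDoorPoloidalWindowRigidityWindow
import Summits.NavierStokesRegularity.NavierStokesRegularity.Theorems.HalfSpaceWindowDoorCirculationCarryingRigidityRotate
import Summits.NavierStokesRegularity.NavierStokesRegularity.Theorems.RellichScarSimilarityCovariance

/-!
# AxisTwistDoor · crux `TiltDominationLoc` (stmt-NavierStokesRegularity-26991) — THE LEAF DICTIONARY:
# `TiltDominationLoc ↔ PoloidalWindowRigidity ∧ CirculationCarryingRigidity ↔ PoloidalWindowRigidity ∧ FilamentPinchLiouville`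

The three routes on the leaf `HalfSpaceWindowDoor.Target` (rung N0-LocalTubeDoorHalfSpace) — `HalfSpaceWindowDoor`
(cruxes 25311 `CirculationCarryingRigidity`, 19708 `PoloidalWindowRigidity`), `FilamentPinchDoor` (cruxes 26430
`FilamentPinchLiouville`, 19708) and `AxisTwistDoor` (crux 26991 `TiltDominationLoc`, everything else proved) — owe THE
SAME research statements, exactly, in the kernel:

* `poloidalRigidity_iff_poloidalWindowRigidity : PoloidalRigidity ↔ FilamentPinchDoor.PoloidalWindowRigidity` — stub 0
  of 26991 IS the shared crux 19708 (energy class automatic, `…EnergyClass.poloidalRigidity_iff_typeI`; window ⇒ slice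
  by analyticity, `…PoloidalWindowRigidityWindow.stub_windowToEverywhere`; direction `e ↦ e₃` by a determinant-one
  rotation, `class_conj_linearIsometryEquiv`, `LIE.isBackwardSingularPoint_zero_conj`, `inner_curl_conj_linearIsometryEquiv`);
* `singularIsPoloidal_iff_circulationCarryingRigidity : SingularIsPoloidal ↔ HalfSpaceWindowDoor.CirculationCarryingRigidity`
  — stub 2 of 26991 IS crux 25311; `singularIsPoloidal_iff_filamentPinchLiouville : SingularIsPoloidal ↔
  FilamentPinchDoor.FilamentPinchLiouville` — and IS crux 26430;
* `tiltDominationLoc_iff_halfSpaceWindowDoor : TiltDominationLoc ↔ PoloidalWindowRigidity ∧ CirculationCarryingRigidity`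
  and `tiltDominationLoc_iff_filamentPinchDoor : TiltDominationLoc ↔ PoloidalWindowRigidity ∧ FilamentPinchLiouville`
  — **crux 26991 ⟺ 19708 ∧ 25311 ⟺ 19708 ∧ 26430.**

WHAT THIS IS NOT: none of 26991 / 19708 / 25311 / 26430 is proved; no Navier–Stokes regularity statement is proved
(Clay A OPEN); the leaf is OPEN.  Seat ns-atd-p1 (LEAD g3).  [cite: arXiv:2501.08976, Rem. 1.3; KochNadirashviliSereginSverak2009, §5]
-/

noncomputable section

-- the summit and its single sub-problem share the name (CONVENTIONS §1), as in every Theorems file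
set_option linter.dupNamespace false

namespace Summit.NavierStokesRegularity.NavierStokesRegularity.Theorems.AxisTwistDoorTiltDominationLocLeafDictionary

open Set Function Filter Topology MeasureTheory Metric
open scoped ENNReal RealInnerProductSpace InnerProductSpace
open Literature.Analysis Literature.Analysis.FluidPDE
open Summit.NavierStokesRegularity.NavierStokesRegularity.Theses.AxisTwistDoor
open Summit.NavierStokesRegularity.NavierStokesRegularity.Theorems.AxisTwistDoorTiltDominationLocDefs
open Summit.NavierStokesRegularity.NavierStokesRegularity.Theorems.AxisTwistDoorTiltDominationLocRigidity
open Summit.NavierStokesRegularity.NavierStokesRegularity.Theorems.AxisTwistDoorTiltDominationLocEnergyClass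
open Summit.NavierStokesRegularity.NavierStokesRegularity.Theorems.PoloidalWindowDoorPoloidalWindowRigidityRotate
  (class_conj_linearIsometryEquiv)
open Summit.NavierStokesRegularity.NavierStokesRegularity.Theorems.PoloidalWindowDoorPoloidalWindowRigidityWindow
  (stub_windowToEverywhere)
open Summit.NavierStokesRegularity.NavierStokesRegularity.Theorems.HalfSpaceWindowDoorCirculationCarryingRigidityRotate
  (exists_linearIsometryEquiv_det_one_symm_single_two)
open Summit.NavierStokesRegularity.NavierStokesRegularity.Theorems.RellichScarSimilarityCovariance
  (LIE.isBackwardSingularPoint_zero_conj)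

variable {C : ℝ} {v : ℝ → EuclideanSpace ℝ (Fin 3) → EuclideanSpace ℝ (Fin 3)}

/-- **The pseudovector law for a rotation taking `e/‖e‖` to `e₃`**: with `L⁻¹ e₃ = ‖e‖⁻¹ e` and `det L = 1`,
`⟪curl v'(s)(y), e₃⟫ = ‖e‖⁻¹ ⟪curl v(s)(L⁻¹ y), e⟫` for the conjugated field `v'(s)(y) = L v(s)(L⁻¹ y)`. -/
theorem inner_curl_conj_e3 (L : EuclideanSpace ℝ (Fin 3) ≃ₗᵢ[ℝ] EuclideanSpace ℝ (Fin 3)) {e : EuclideanSpace ℝ (Fin 3)}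
    (hL : L.symm (EuclideanSpace.single 2 1) = (‖e‖⁻¹ : ℝ) • e)
    (hdet : (L : EuclideanSpace ℝ (Fin 3) →L[ℝ] EuclideanSpace ℝ (Fin 3)).det = 1)
    (u : EuclideanSpace ℝ (Fin 3) → EuclideanSpace ℝ (Fin 3)) (y : EuclideanSpace ℝ (Fin 3)) :
    ⟪curl (fun z => L (u (L.symm z))) y, EuclideanSpace.single 2 1⟫_ℝ = ‖e‖⁻¹ * ⟪curl u (L.symm y), e⟫_ℝ := by
  have h := inner_curl_conj_linearIsometryEquiv L u y (L.symm (EuclideanSpace.single 2 1))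
  rw [LinearIsometryEquiv.apply_symm_apply, hdet, one_mul, hL, inner_smul_right] at h
  exact h

/-! ### Stub 0 IS the shared crux 19708 -/

/-- **`PoloidalRigidity ↔ PoloidalWindowRigidity`** (26991's stub 0 ⟺ the shared crux 19708 of
`FilamentPinchDoor` / `HalfSpaceWindowDoor`). -/
theorem poloidalRigidity_iff_poloidalWindowRigidity :
    PoloidalRigidity ↔ Summit.NavierStokesRegularity.NavierStokesRegularity.Theses.FilamentPinchDoor.PoloidalWindowRigidity := by
  refine ⟨fun hP => ?_, poloidalRigidity_of_poloidalWindowRigidity⟩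
  have hP₀ := poloidalRigidity_iff_typeI.1 hP
  intro C v hrate hcont hmild hdiv
  obtain ⟨hcurl, hspread⟩ := stub_windowToEverywhere C v hrate hcont hmild hdiv
  refine ⟨hcurl, fun e he hwin hsing => ?_⟩
  have hall : ∀ s < 0, ∀ y, ⟪curl (v s) y, e⟫_ℝ = 0 := hspread e he hwin
  obtain ⟨L, hL, hdet⟩ := exists_linearIsometryEquiv_det_one_symm_single_two he
  obtain ⟨hrate', hcont', hmild', hdiv'⟩ := class_conj_linearIsometryEquiv L hrate hcont hmild hdiv
  have hpol' : ∀ s < 0, ∀ y, ⟪curl ((fun t x => L (v t (L.symm x))) s) y,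
      (EuclideanSpace.single (2 : Fin 3) (1 : ℝ))⟫_ℝ = 0 := by
    intro s hs y
    show ⟪curl (fun z => L (v s (L.symm z))) y, EuclideanSpace.single 2 1⟫_ℝ = 0
    rw [inner_curl_conj_e3 L hL hdet, hall s hs (L.symm y), mul_zero]
  exact hP₀ C _ hrate' hcont' hmild' hdiv' hpol' (LIE.isBackwardSingularPoint_zero_conj L hsing)

/-! ### Stub 2 IS crux 25311 (and crux 26430) -/

/-- **`SingularIsPoloidal ↔ CirculationCarryingRigidity`** (26991's stub 2 ⟺ HalfSpaceWindowDoor's crux 25311). -/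
theorem singularIsPoloidal_iff_circulationCarryingRigidity :
    SingularIsPoloidal ↔ Summit.NavierStokesRegularity.NavierStokesRegularity.Theses.HalfSpaceWindowDoor.CirculationCarryingRigidity := by
  refine ⟨fun hS => ?_, singularIsPoloidal_of_circulationCarryingRigidity⟩
  have hS₀ := singularIsPoloidal_iff_core.1 hS
  intro C v hrate hcont hmild hdiv e he hnn hpos hsing
  obtain ⟨s₀, hs₀, y₀, hpos₀⟩ := hpos
  obtain ⟨L, hL, hdet⟩ := exists_linearIsometryEquiv_det_one_symm_single_two he
  obtain ⟨hrate', hcont', hmild', hdiv'⟩ := class_conj_linearIsometryEquiv L hrate hcont hmild hdiv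
  have hnorm : 0 < ‖e‖ := norm_pos_iff.2 he
  have hnn' : ∀ s < 0, ∀ y, 0 ≤ ⟪curl ((fun t x => L (v t (L.symm x))) s) y,
      (EuclideanSpace.single (2 : Fin 3) (1 : ℝ))⟫_ℝ := by
    intro s hs y
    show 0 ≤ ⟪curl (fun z => L (v s (L.symm z))) y, EuclideanSpace.single 2 1⟫_ℝ
    rw [inner_curl_conj_e3 L hL hdet]
    exact mul_nonneg (inv_nonneg.2 hnorm.le) (hnn s hs (L.symm y))
  have hpol' := hS₀ C _ hrate' hcont' hmild' hdiv' hnn' (LIE.isBackwardSingularPoint_zero_conj L hsing)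
  have h0 : ⟪curl ((fun t x => L (v t (L.symm x))) s₀) (L y₀), (EuclideanSpace.single (2 : Fin 3) (1 : ℝ))⟫_ℝ = 0 :=
    hpol' s₀ hs₀ (L y₀)
  have h1 : ⟪curl (fun z => L (v s₀ (L.symm z))) (L y₀), EuclideanSpace.single 2 1⟫_ℝ = ‖e‖⁻¹ * ⟪curl (v s₀) y₀, e⟫_ℝ := by
    rw [inner_curl_conj_e3 L hL hdet, LinearIsometryEquiv.symm_apply_apply]
  have h2 : ‖e‖⁻¹ * ⟪curl (v s₀) y₀, e⟫_ℝ = 0 := h1 ▸ h0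
  rcases mul_eq_zero.1 h2 with h | h
  · exact absurd h (inv_ne_zero hnorm.ne')
  · exact absurd h hpos₀.ne'

/-- **`SingularIsPoloidal ↔ FilamentPinchLiouville`** (26991's stub 2 ⟺ FilamentPinchDoor's crux 26430). -/
theorem singularIsPoloidal_iff_filamentPinchLiouville :
    SingularIsPoloidal ↔ Summit.NavierStokesRegularity.NavierStokesRegularity.Theses.FilamentPinchDoor.FilamentPinchLiouville := by
  refine ⟨fun hS => ?_, singularIsPoloidal_of_filamentPinchLiouville⟩
  have hC := singularIsPoloidal_iff_circulationCarryingRigidity.1 hS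
  intro C v π H hrate hcont hmild hdiv _ _ _ e he hnn _ hsing s hs y
  by_contra hne
  have hpos : 0 < ⟪curl (v s) y, e⟫_ℝ := lt_of_le_of_ne (hnn s hs y) (Ne.symm hne)
  exact hC C v hrate hcont hmild hdiv e he hnn ⟨s, hs, y, hpos⟩ hsing

/-! ### The crux IS the pair of research cruxes of the other two routes -/

/-- **`TiltDominationLoc ↔ PoloidalWindowRigidity ∧ CirculationCarryingRigidity`**: crux 26991 ⟺ 19708 ∧ 25311. -/
theorem tiltDominationLoc_iff_halfSpaceWindowDoor :
    TiltDominationLoc ↔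
      Summit.NavierStokesRegularity.NavierStokesRegularity.Theses.FilamentPinchDoor.PoloidalWindowRigidity ∧
      Summit.NavierStokesRegularity.NavierStokesRegularity.Theses.HalfSpaceWindowDoor.CirculationCarryingRigidity := by
  rw [tiltDominationLoc_iff_oneSignedRigidity, oneSignedRigidity_iff, poloidalRigidity_iff_poloidalWindowRigidity,
    singularIsPoloidal_iff_circulationCarryingRigidity]

/-- **`TiltDominationLoc ↔ PoloidalWindowRigidity ∧ FilamentPinchLiouville`**: crux 26991 ⟺ 19708 ∧ 26430, i.e. route
`AxisTwistDoor` owes exactly what route `FilamentPinchDoor` owes. -/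
theorem tiltDominationLoc_iff_filamentPinchDoor :
    TiltDominationLoc ↔
      Summit.NavierStokesRegularity.NavierStokesRegularity.Theses.FilamentPinchDoor.PoloidalWindowRigidity ∧
      Summit.NavierStokesRegularity.NavierStokesRegularity.Theses.FilamentPinchDoor.FilamentPinchLiouville := by
  rw [tiltDominationLoc_iff_oneSignedRigidity, oneSignedRigidity_iff, poloidalRigidity_iff_poloidalWindowRigidity,
    singularIsPoloidal_iff_filamentPinchLiouville]

/-- The two copies of item 19708 in the route files `FilamentPinchDoor` and `HalfSpaceWindowDoor` are the same
proposition (definitionally). -/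
theorem poloidalWindowRigidity_filamentPinch_iff_halfSpace :
    Summit.NavierStokesRegularity.NavierStokesRegularity.Theses.FilamentPinchDoor.PoloidalWindowRigidity ↔
      Summit.NavierStokesRegularity.NavierStokesRegularity.Theses.HalfSpaceWindowDoor.PoloidalWindowRigidity :=
  Iff.rfl

end Summit.NavierStokesRegularity.NavierStokesRegularity.Theorems.AxisTwistDoorTiltDominationLocLeafDictionary

end
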